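import Literature.Computability.Complexity.NegacyclicFFT
import Literature.Computability.Complexity.StackFFTLevel
import HarnessLib

/-!
# The negacyclic FFT on a batch: level passes are tree steps (forward) and subtree merges (inverse)

Literature / complexity toolkit, the glue between `NegacyclicFFT.lean` (the ℕ-level transforms
`fwdN`, `invN` of the recursive multiplier `negMulRec`) and `StackFFTLevel.lean` (the machine's
level pass, whose list-level effect is `levelOut g₁ g₂ h Fs Bs` with children twiddles
`childTw m Fs`).  The stack machine runs the transform breadth-first over a flat BATCH of
instances; this file proves that doing so computes `fwdN` / `invN` instance by instance:

* `gF₁`, `gF₂`, `gI₁`, `gI₂` — the pair functions of `pairFwd` / `pairInv`; `bflyN_eq_zips`,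
  `ibflyN_eq_zips` (a butterfly on a segment of length `2h` is the two zips of `levelOut`);
  lengths `length_fwdN`, `length_ibflyN`, `length_invN`;
* forward: `stepN` (one tree step on a batch of nodes `(F, segment)`), `map_fst_stepN`,
  `flatMap_snd_stepN`, `length_snd_stepN`, **`levelOut_gF_eq_stepN`** (a forward level pass =
  one tree step: blocks `(stepN ps).flatMap snd`, twiddles `childTw`), and
  **`flatMap_iterate_stepN`**: `lv` passes compute `fwdN F lv L` on every instance;
* inverse: `invBatch r Fs M` (twiddle `F` owns the next `2^r` blocks, inverted below it),
  `invBatch_zero`, `length_invBatch`, and **`levelOut_gI_invBatch`**: an inverse level pass with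
  half-length `2^r` and the PARENT twiddles `Fs` turns `invBatch r (childTw Fs) M` into
  `invBatch (r+1) Fs M` — so the inverse passes, run from the leaves up with the twiddle lists
  of the forward passes in reverse order, compute `invN F lv` on every instance.

## References

* J. von zur Gathen, J. Gerhard, *Modern Computer Algebra*, 3rd ed., CUP 2013, §8.2 (the FFT
  as a butterfly network, level by level), §8.3 Alg. 8.20. (Folklore material, fully proved here.)
* D. G. Cantor, E. Kaltofen, Acta Inform. 28 (1991) 693–701.
-/

namespace Literature.Computability.Complexity

namespace NegFFT

open _root_.Computability

variable {N m : ℕ}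

/-! ### Lengths of the ℕ-level transforms -/

/-- `fwdN` preserves the length `2^lv`. [folklore] -/
theorem length_fwdN : ∀ (F lv : ℕ) {L : List (List ℕ)}, L.length = 2 ^ lv → (fwdN N m F lv L).length = 2 ^ lv
  | F, 0, L, hL => hL
  | F, lv + 1, L, hL => by
    have hb := length_bflyN (N := N) (m := m) (F / 2) L
    have h1 : ((bflyN N m (F / 2) L).take (L.length / 2)).length = 2 ^ lv := by
      rw [List.length_take, hb, hL, pow_succ]; omega
    have h2 : ((bflyN N m (F / 2) L).drop (L.length / 2)).length = 2 ^ lv := by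
      rw [List.length_drop, hb, hL, pow_succ]; omega
    rw [fwdN, List.length_append, length_fwdN _ lv h1, length_fwdN _ lv h2, pow_succ]; ring

/-- `ibflyN` has the even part of the length. [folklore] -/
theorem length_ibflyN (E : ℕ) (Ms : List (List ℕ)) : (ibflyN N m E Ms).length = 2 * (Ms.length / 2) := by
  unfold ibflyN
  simp only [List.length_append, List.length_zipWith, List.length_take, List.length_drop]
  omega

/-- `invN` preserves the length `2^lv`. [folklore] -/
theorem length_invN : ∀ (F lv : ℕ) {M : List (List ℕ)}, M.length = 2 ^ lv → (invN N m F lv M).length = 2 ^ lv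
  | F, 0, M, hM => hM
  | F, lv + 1, M, hM => by
    have h1 : (M.take (M.length / 2)).length = 2 ^ lv := by rw [List.length_take, hM, pow_succ]; omega
    have h2 : (M.drop (M.length / 2)).length = 2 ^ lv := by rw [List.length_drop, hM, pow_succ]; omega
    rw [invN, length_ibflyN, List.length_append, length_invN _ lv h1, length_invN _ lv h2, pow_succ]; omega

/-! ### One forward level on a batch of segments -/

/-- The forward pair functions of `Com.pairFwd`. [folklore] -/
def gF₁ (N m : ℕ) : ℕ → List ℕ → List ℕ → List ℕ := fun E u w => vaddMod N u (negShift N (2 * m) E w)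
/-- The forward pair functions of `Com.pairFwd`, second half. [folklore] -/
def gF₂ (N m : ℕ) : ℕ → List ℕ → List ℕ → List ℕ := fun E u w => vsubMod N u (negShift N (2 * m) E w)
/-- The inverse pair functions of `Com.pairInv`. [folklore] -/
def gI₁ (N : ℕ) : ℕ → List ℕ → List ℕ → List ℕ := fun _ u w => vscaleMod N (inv2N N) (vaddMod N u w)
/-- The inverse pair functions of `Com.pairInv`, second half. [folklore] -/
def gI₂ (N m : ℕ) : ℕ → List ℕ → List ℕ → List ℕ := fun E u w => negShift N (2 * m) (4 * m - E) (vscaleMod N (inv2N N) (vsubMod N u w))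

/-- On a segment of length `2h`, the butterfly is the two zips of `levelOut`. [folklore] -/
theorem bflyN_eq_zips {E h : ℕ} {L : List (List ℕ)} (hL : L.length = 2 * h) :
    bflyN N m E L = List.zipWith (gF₁ N m E) (L.take h) ((L.drop h).take h) ++ List.zipWith (gF₂ N m E) (L.take h) ((L.drop h).take h) := by
  have hh : L.length / 2 = h := by rw [hL]; omega
  have hd : (L.drop h).take h = L.drop h := List.take_of_length_le (by rw [List.length_drop, hL]; omega)
  unfold bflyN gF₁ gF₂; rw [hh, hd]

/-- On a segment of length `2h`, the inverse butterfly is the two zips of `levelOut`. [folklore] -/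
theorem ibflyN_eq_zips {E h : ℕ} {M : List (List ℕ)} (hM : M.length = 2 * h) :
    ibflyN N m E M = List.zipWith (gI₁ N E) (M.take h) ((M.drop h).take h) ++ List.zipWith (gI₂ N m E) (M.take h) ((M.drop h).take h) := by
  have hh : M.length / 2 = h := by rw [hM]; omega
  have hd : (M.drop h).take h = M.drop h := List.take_of_length_le (by rw [List.length_drop, hM]; omega)
  unfold ibflyN gI₁ gI₂; rw [hh, hd]

variable (N m)

/-- One level of the tree on a batch: each node `(F, L)` splits into `(F/2, first half of the
butterfly)` and `(F/2 + 2m, second half)`. [folklore] -/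
def stepN (ps : List (ℕ × List (List ℕ))) : List (ℕ × List (List ℕ)) :=
  ps.flatMap fun p => [(p.1 / 2, (bflyN N m (p.1 / 2) p.2).take (p.2.length / 2)),
    (p.1 / 2 + 2 * m, (bflyN N m (p.1 / 2) p.2).drop (p.2.length / 2))]

variable {N m}

/-- The exponents after a step are the children twiddles. [folklore] -/
theorem map_fst_stepN (ps : List (ℕ × List (List ℕ))) : (stepN N m ps).map Prod.fst = childTw m (ps.map Prod.fst) := by
  induction ps with
  | nil => rfl
  | cons p ps ih => simp only [stepN, List.flatMap_cons, List.map_append, List.map_cons, List.map_nil, childTw] at ih ⊢; rw [ih]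

/-- The blocks after a step are the butterflies. [folklore] -/
theorem flatMap_snd_stepN (ps : List (ℕ × List (List ℕ))) :
    (stepN N m ps).flatMap Prod.snd = ps.flatMap fun p => bflyN N m (p.1 / 2) p.2 := by
  induction ps with
  | nil => rfl
  | cons p ps ih =>
    simp only [stepN, List.flatMap_cons, List.flatMap_append] at ih ⊢
    rw [ih, List.flatMap_nil, List.append_nil, List.take_append_drop]

/-- Segment lengths halve in a step. [folklore] -/
theorem length_snd_stepN {ps : List (ℕ × List (List ℕ))} {h : ℕ} (hps : ∀ p ∈ ps, p.2.length = 2 * h) :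
    ∀ p' ∈ stepN N m ps, p'.2.length = h := by
  intro p' hp'
  simp only [stepN, List.mem_flatMap, List.mem_cons, List.not_mem_nil, or_false] at hp'
  obtain ⟨p, hp, hp'⟩ := hp'
  have hb := length_bflyN (N := N) (m := m) (p.1 / 2) p.2
  rw [hps p hp] at hb
  rcases hp' with rfl | rfl
  · simp only [List.length_take, hb, hps p hp]; omega
  · simp only [List.length_drop, hb, hps p hp]; omega

/-- **A forward level pass is one step of the tree on the batch**: `levelOut` with the pair
functions of `pairFwd` over the twiddles and blocks of a batch of nodes with segments of length
`2h` produces the blocks of `stepN`, and `childTw` its twiddles. [folklore] -/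
theorem levelOut_gF_eq_stepN {h : ℕ} : ∀ (ps : List (ℕ × List (List ℕ))), (∀ p ∈ ps, p.2.length = 2 * h) →
    levelOut (gF₁ N m) (gF₂ N m) h (ps.map Prod.fst) (ps.flatMap Prod.snd) = (stepN N m ps).flatMap Prod.snd
  | [], _ => by simp [levelOut, stepN]
  | p :: ps, hps => by
    have hp : p.2.length = 2 * h := hps p (by simp)
    rw [List.map_cons, List.flatMap_cons, levelOut, flatMap_snd_stepN, List.flatMap_cons, ← flatMap_snd_stepN,
      ← levelOut_gF_eq_stepN ps (fun x hx => hps x (by simp [hx])), bflyN_eq_zips hp]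
    have h1 : (p.2 ++ ps.flatMap Prod.snd).take h = p.2.take h := by
      rw [List.take_append_of_le_length (by rw [hp]; omega)]
    have h2 : ((p.2 ++ ps.flatMap Prod.snd).drop h).take h = (p.2.drop h).take h := by
      rw [List.drop_append_of_le_length (by rw [hp]; omega), List.take_append_of_le_length (by rw [List.length_drop, hp]; omega)]
    have h3 : (p.2 ++ ps.flatMap Prod.snd).drop (2 * h) = ps.flatMap Prod.snd := by
      rw [← hp, List.drop_append_of_le_length le_rfl, List.drop_length, List.nil_append]
    rw [h1, h2, h3]

/-- **`lv` forward levels compute `fwdN` on every instance of the batch.** [folklore] -/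
theorem flatMap_iterate_stepN : ∀ (lv : ℕ) (ps : List (ℕ × List (List ℕ))), (∀ p ∈ ps, p.2.length = 2 ^ lv) →
    ((stepN N m)^[lv] ps).flatMap Prod.snd = ps.flatMap fun p => fwdN N m p.1 lv p.2
  | 0, ps, _ => by simp [fwdN]
  | lv + 1, ps, hps => by
    rw [Function.iterate_succ_apply, flatMap_iterate_stepN lv (stepN N m ps)
      (length_snd_stepN (h := 2 ^ lv) (fun p hp => by rw [hps p hp, pow_succ]; ring))]
    induction ps with
    | nil => rfl
    | cons p ps ih =>
      have := ih (fun x hx => hps x (by simp [hx]))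
      simp only [stepN, List.flatMap_cons, List.flatMap_append, List.flatMap_nil, List.append_nil] at this ⊢
      rw [this, fwdN]

/-! ### One inverse level on a batch of subtrees -/

variable (N m)

/-- The batch of inverted subtrees: twiddles `Fs`, each owning the next `2^r` blocks of `M`.
[folklore] -/
def invBatch (r : ℕ) : List ℕ → List (List ℕ) → List (List ℕ)
  | [], _ => []
  | F :: Fs, M => invN N m F r (M.take (2 ^ r)) ++ invBatch r Fs (M.drop (2 ^ r))

variable {N m}

/-- At the leaves the batch is the block list itself. [folklore] -/
theorem invBatch_zero : ∀ (Fs : List ℕ) (M : List (List ℕ)), M.length = Fs.length → invBatch N m 0 Fs M = M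
  | [], M, hM => by rw [List.length_nil, List.length_eq_zero_iff] at hM; subst hM; rfl
  | F :: Fs, M, hM => by
    rw [invBatch, invN, pow_zero, invBatch_zero Fs (M.drop 1) (by rw [List.length_drop, hM, List.length_cons]; omega),
      List.take_append_drop]

/-- Length of an inverted batch. [folklore] -/
theorem length_invBatch (r : ℕ) : ∀ (Fs : List ℕ) (M : List (List ℕ)), M.length = Fs.length * 2 ^ r →
    (invBatch N m r Fs M).length = Fs.length * 2 ^ r
  | [], _, _ => by simp [invBatch]
  | F :: Fs, M, hM => by
    rw [List.length_cons] at hM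
    have h1 : (M.take (2 ^ r)).length = 2 ^ r := by rw [List.length_take, hM]; exact min_eq_left (by nlinarith)
    rw [invBatch, List.length_append, length_invN _ _ h1, length_invBatch r Fs (M.drop (2 ^ r))
      (by rw [List.length_drop, hM]; ring_nf; omega), List.length_cons]; ring

/-- **An inverse level pass merges sibling subtrees**: `levelOut` with the pair functions of
`pairInv`, half-length `2^r` and the PARENT twiddles `Fs` turns the inverted children
`invBatch r (childTw Fs) M` into `invBatch (r+1) Fs M`. [folklore] -/
theorem levelOut_gI_invBatch (r : ℕ) : ∀ (Fs : List ℕ) (M : List (List ℕ)), M.length = Fs.length * 2 ^ (r + 1) →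
    levelOut (gI₁ N) (gI₂ N m) (2 ^ r) Fs (invBatch N m r (childTw m Fs) M) = invBatch N m (r + 1) Fs M
  | [], M, _ => by simp [invBatch, levelOut]
  | F :: Fs, M, hM => by
    rw [List.length_cons] at hM
    have hM2 : 2 ^ (r + 1) ≤ M.length := by rw [hM]; nlinarith
    have hr2 : 2 ^ (r + 1) = 2 ^ r + 2 ^ r := by rw [pow_succ]; ring
    have hct : childTw m (F :: Fs) = F / 2 :: (F / 2 + 2 * m) :: childTw m Fs := by simp [childTw]
    rw [hct, invBatch, invBatch, levelOut, invBatch]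
    set A := invN N m (F / 2) r (M.take (2 ^ r)) with hA
    set B := invN N m (F / 2 + 2 * m) r ((M.drop (2 ^ r)).take (2 ^ r)) with hB
    have hlA : A.length = 2 ^ r := length_invN _ _ (by rw [List.length_take, min_eq_left]; omega)
    have hlB : B.length = 2 ^ r := length_invN _ _ (by rw [List.length_take, List.length_drop, min_eq_left]; omega)
    set C := invBatch N m r (childTw m Fs) ((M.drop (2 ^ r)).drop (2 ^ r)) with hC
    have e1 : (A ++ (B ++ C)).take (2 ^ r) = A := by
      rw [List.take_append_of_le_length (by rw [hlA]), List.take_of_length_le (by rw [hlA])]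
    have e3a : (A ++ (B ++ C)).drop (2 ^ r) = B ++ C := by
      rw [List.drop_append_of_le_length (by rw [hlA]), List.drop_of_length_le (by rw [hlA]), List.nil_append]
    have e2 : ((A ++ (B ++ C)).drop (2 ^ r)).take (2 ^ r) = B := by
      rw [e3a, List.take_append_of_le_length (by rw [hlB]), List.take_of_length_le (by rw [hlB])]
    have e3 : (A ++ (B ++ C)).drop (2 * 2 ^ r) = C := by
      rw [two_mul, ← List.drop_drop, e3a, List.drop_append_of_le_length (by rw [hlB]), List.drop_of_length_le (by rw [hlB]),
        List.nil_append]
    have hCdef : C = invBatch N m r (childTw m Fs) (M.drop (2 ^ (r + 1))) := by rw [hC, List.drop_drop, hr2]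
    rw [e1, e2, e3, hCdef, levelOut_gI_invBatch r Fs (M.drop (2 ^ (r + 1))) (by rw [List.length_drop, hM]; ring_nf; omega)]
    congr 1
    -- the merged node
    have hM' : (M.take (2 ^ (r + 1))).length = 2 * 2 ^ r := by rw [List.length_take, min_eq_left hM2, pow_succ]; ring
    rw [invN, hM', show 2 * 2 ^ r / 2 = 2 ^ r by omega, List.take_take, min_eq_left (by omega), ← hA,
      List.drop_take, show 2 ^ (r + 1) - 2 ^ r = 2 ^ r by omega, ← hB,
      ibflyN_eq_zips (h := 2 ^ r) (by rw [List.length_append, hlA, hlB]; ring)]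
    rw [List.take_append_of_le_length (by rw [hlA]), List.take_of_length_le (by rw [hlA]),
      List.drop_append_of_le_length (by rw [hlA]), List.drop_of_length_le (by rw [hlA]), List.nil_append,
      List.take_of_length_le (by rw [hlB])]

end NegFFT


end Literature.Computability.Complexity
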